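import Summits.QuantumFields.YangMills.Theorems.UnitScaleGibbsCollarCoboundary
import Summits.QuantumFields.YangMills.Theorems.UnitScaleGibbsTruncatedPotentialEnergyMass
import HarnessLib

/-!
# (R7-row) of `stub_linTest` v3.2 (LINE 28 «GrossTransfer», stmt-QuantumFields-23083): THE COLLAR MASS OF THE CUTOFF COMMUTATORS ON `ℤ³` —
# `W = Σ_{shell} Σ_ν (|δ₂E₁| + |δ₂C₂|) ≤ #shell · (135∕2)·(ρ·C₂∕N³ + ρ₂·C₁∕N²)·M₀`

Cell `ym3-torus` (YM ladder rung R3 = continuum SU(2) Yang–Mills on the three-torus — a RUNG, NOT the Clay problem: not d = 4, not infinite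
volume, not a mass gap), width seat `ym-ust-19936-w3` gen 18, on the pen of record's dispatch (★w2-19936 g15 KNIT-E2 «(R7-row) → any idle width»,
KNIT-PLAN v2 S4 R7).  THEOREMS ONLY (0 `def`), chart-free, in the letters of ✓COLLAR-COBD `UnitScaleGibbsCollarCoboundary` (the commutators
`E₁(x,μ,ν) = (χ(x+e_μ) − χ x)·a(x+e_μ,ν) − (χ(x+e_ν) − χ x)·a(x+e_ν,μ)`, `C₂(x,μ,ν) = Σ_κ (χ x − χ(x−e_κ))·γ(x−e_κ,κ,μ,ν)` and their coboundaries
`Σ_μ (E₁(x−e_μ,μ,ν) − E₁(x,μ,ν))`, `Σ_μ (C₂(x−e_μ,μ,ν) − C₂(x,μ,ν))`) and of ✓MONOPOLE `UnitScaleGibbsGreenPotentialMonopoleFarField` (`ω` supported in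
`box p ℓ`, `β = (G∕2)∗ω`, `a = δ₂β`, `γ = d₂β`, kernel rows `hK1`∕`hK2`, `M₀ = Σ|ω|`); the cutoff `χ` has `χ = 1` on `box p R`, `χ = 0` off `box p S` and
the `C^{1,1}` rows of ✓`UnitScaleGibbsSmoothLatticeCutoff.exists_smooth_cutoff` (`ρ = 2∕R`, `ρ₂ = 4∕R²`).

* §0 the cutoff's SECOND-DIFFERENCE ROW `|χ(x+e_κ+e_μ) − χ(x+e_κ) − χ(x+e_μ) + χ x| ≤ ρ₂` in the three shapes COLLAR-COBD consumes (pure centred, mixed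
  backward–forward, backward–backward: `cutoff_sd_pure`, `cutoff_sd_mixed`, `cutoff_sd_back`) — each is the given row at a shifted point;
* §1 SUPPORT: both coboundaries vanish on the inner plateau `box p (R−2)` and outside `box p (S+2)` (✓(Z-b) plateau∕outside rows at `x` and `x − e_μ`);
* §2 POINTWISE on the shell `x ∉ box p (R−2)`: with ABSTRACT far-field sizes (`|a| ≤ As`, `|∇a| ≤ Ad`, `|γ| ≤ Gs`, `|∇γ| ≤ Gd` off `box p Q`,
  `Q + 4 ≤ R`): `Σ_ν (|δ₂E₁(x,ν)| + |δ₂C₂(x,ν)|) ≤ 18ρ·Ad + 18ρ₂·As + 27ρ·Gd + 27ρ₂·Gs` (✓COLLAR-COBD `abs_deltaTwo_E1_le`∕`_C2_le`);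
* §3 SUMMED over any finite `B`: `Σ_{x∈B} Σ_ν (|δ₂E₁| + |δ₂C₂|) ≤ #(B ∩ (box p (S+2) ∖ box p (R−2)))·(18ρ·Ad + 18ρ₂·As + 27ρ·Gd + 27ρ₂·Gs)`;
* §4 THE MONOPOLE INSTANCE (`d = 3`): `As = Gs = (3∕2)(C₁∕N²)M₀`, `Ad = Gd = (3∕2)(C₂∕N³)M₀` at `Q := N + ℓ`, `N ≥ 2`, `N + ℓ + 4 ≤ R` ⇒
  ★★★`collarMass_le_far : Σ_{x∈B} Σ_ν (|δ₂E₁| + |δ₂C₂|) ≤ #(B ∩ shell)·((135∕2)·(ρ·(C₂∕N³) + ρ₂·(C₁∕N²))·M₀)` and the `B`-free variant — with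
  `ρ = 2∕R`, `ρ₂ = 4∕R²`, `S = 3R`, `N ≍ R∕2`, `#shell ≤ (6R+5)³`: `W ≤ A·(C₁ + C₂)·M₀∕R`, the KNIT-PLAN's R7 size.
HONEST: `ℤ³` finite-sum bookkeeping over landed rows; `--supports` helper; proves NO stub; `stub_linTest`, (Q), stmt-23083∕23133∕23134, `HistoryTailL`
(stmt-QuantumFields-19936) are NOT proved; the Yang–Mills mass gap is NOT proved.
References: Giaquinta (1983) Ch. III §2 (cutoff commutators) [Giaquinta1984]; Lawler 1991 Thm 1.5.5 (kernel rows) [Lawler1991].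
-/

noncomputable section

set_option autoImplicit false

open scoped BigOperators
open Finset

namespace Summit.QuantumFields.YangMills.Theorems.UnitScaleGibbsTruncatedPotentialCollarMass

open Literature.Probability.LatticeModels (latticeGreen)
open Literature.MathematicalPhysics.QuantumFieldTheory.Balaban1983to89.B4Eq19LatticeOperators
open Summit.QuantumFields.YangMills.Theorems.UnitScaleGibbsCollarCoboundary (abs_deltaTwo_E1_le abs_deltaTwo_C2_le)
open Summit.QuantumFields.YangMills.Theorems.CovariantDischargeCutoffCommutator (curl_comm_eq_zero_of_mem_box curl_comm_eq_zero_of_not_mem_box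
  deltaThree_comm_eq_zero_of_mem_box deltaThree_comm_eq_zero_of_not_mem_box)
open Summit.QuantumFields.YangMills.Theorems.UnitScaleGibbsGreenPotentialMonopoleFarField (abs_potential_le_far_monopole
  abs_fdiff_potential_le_far_monopole abs_dTwo_le_far_monopole abs_fdiff_dTwo_le_far_monopole)

/-! ## §0 The cutoff's second-difference row in COLLAR-COBD's three shapes -/

section Cutoff

variable {d : ℕ} {χ : Zd d → ℝ} {ρ₂ : ℝ}
  (hχ2 : ∀ x (κ μ : Fin d), |χ (x + unitVec κ + unitVec μ) - χ (x + unitVec κ) - χ (x + unitVec μ) + χ x| ≤ ρ₂)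

include hχ2 in
/-- Pure centred second difference: `|(χ(x+e_κ) − χ x) − (χ x − χ(x−e_κ))| ≤ ρ₂` (the row at `x − e_κ`). [folklore] -/
theorem cutoff_sd_pure (x : Zd d) (κ : Fin d) : |(χ (x + unitVec κ) - χ x) - (χ x - χ (x - unitVec κ))| ≤ ρ₂ := by
  have h := hχ2 (x - unitVec κ) κ κ
  rw [sub_add_cancel] at h
  rw [show (χ (x + unitVec κ) - χ x) - (χ x - χ (x - unitVec κ)) = χ (x + unitVec κ) - χ x - χ x + χ (x - unitVec κ) by ring]
  exact h

include hχ2 in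
/-- Mixed backward–forward second difference: `|(χ(x+e_ι) − χ x) − (χ(x−e_κ+e_ι) − χ(x−e_κ))| ≤ ρ₂` (the row at `x − e_κ`). [folklore] -/
theorem cutoff_sd_mixed (x : Zd d) (κ ι : Fin d) : |(χ (x + unitVec ι) - χ x) - (χ (x - unitVec κ + unitVec ι) - χ (x - unitVec κ))| ≤ ρ₂ := by
  have h := hχ2 (x - unitVec κ) κ ι
  rw [sub_add_cancel] at h
  rw [show (χ (x + unitVec ι) - χ x) - (χ (x - unitVec κ + unitVec ι) - χ (x - unitVec κ))
      = χ (x + unitVec ι) - χ x - χ (x - unitVec κ + unitVec ι) + χ (x - unitVec κ) by ring]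
  exact h

include hχ2 in
/-- Backward–backward second difference: `|(χ(x−e_μ) − χ(x−e_μ−e_κ)) − (χ x − χ(x−e_κ))| ≤ ρ₂` (the row at `x − e_μ − e_κ`). [folklore] -/
theorem cutoff_sd_back (x : Zd d) (μ κ : Fin d) : |(χ (x - unitVec μ) - χ (x - unitVec μ - unitVec κ)) - (χ x - χ (x - unitVec κ))| ≤ ρ₂ := by
  have h := hχ2 (x - unitVec μ - unitVec κ) κ μ
  have e1 : x - unitVec μ - unitVec κ + unitVec κ + unitVec μ = x := by abel
  have e2 : x - unitVec μ - unitVec κ + unitVec κ = x - unitVec μ := by abel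
  have e3 : x - unitVec μ - unitVec κ + unitVec μ = x - unitVec κ := by abel
  rw [e1, e2, e3] at h
  rw [show (χ (x - unitVec μ) - χ (x - unitVec μ - unitVec κ)) - (χ x - χ (x - unitVec κ))
      = -(χ x - χ (x - unitVec μ) - χ (x - unitVec κ) + χ (x - unitVec μ - unitVec κ)) by ring, abs_neg]
  exact h

end Cutoff

/-! ## §1 Support: the coboundaries vanish on the inner plateau and outside -/

section Support

variable {d : ℕ} (χ : Zd d → ℝ) (a : Zd d → Fin d → ℝ) (γ : Zd d → Fin d → Fin d → Fin d → ℝ)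
  (E1 C2 : Zd d → Fin d → Fin d → ℝ)
  (hE1 : ∀ x μ ν, E1 x μ ν = (χ (x + unitVec μ) - χ x) * a (x + unitVec μ) ν - (χ (x + unitVec ν) - χ x) * a (x + unitVec ν) μ)
  (hC2 : ∀ x μ ν, C2 x μ ν = ∑ κ, (χ x - χ (x - unitVec κ)) * γ (x - unitVec κ) κ μ ν)
  (p : Zd d) (R S : ℤ) (hχ1 : ∀ y ∈ box p R, χ y = 1) (hχ0 : ∀ y, y ∉ box p S → χ y = 0)

include hE1 hχ1 in
/-- `δ₂E₁(x,ν) = 0` on the inner plateau `x ∈ box p (R − 2)` (`E₁` vanishes at `x` and at every `x − e_μ`, all in `box p (R−1)`). [folklore] -/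
theorem deltaTwo_E1_eq_zero_of_mem_box (x : Zd d) (hx : x ∈ box p (R - 2)) (ν : Fin d) :
    ∑ μ, (E1 (x - unitVec μ) μ ν - E1 x μ ν) = 0 := by
  refine Finset.sum_eq_zero fun μ _ => ?_
  have hx1 : x ∈ box p (R - 1) := box_mono p (by linarith) hx
  have hxμ : x - unitVec μ ∈ box p (R - 1) := by
    have h := sub_unitVec_mem_box hx μ
    rwa [show R - 2 + 1 = R - 1 by ring] at h
  rw [hE1, hE1, curl_comm_eq_zero_of_mem_box hχ1 hxμ a μ ν, curl_comm_eq_zero_of_mem_box hχ1 hx1 a μ ν, sub_self]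

include hE1 hχ0 in
/-- `δ₂E₁(x,ν) = 0` outside `box p (S + 2)`. [folklore] -/
theorem deltaTwo_E1_eq_zero_of_not_mem_box (x : Zd d) (hx : x ∉ box p (S + 2)) (ν : Fin d) :
    ∑ μ, (E1 (x - unitVec μ) μ ν - E1 x μ ν) = 0 := by
  refine Finset.sum_eq_zero fun μ _ => ?_
  have hx1 : x ∉ box p (S + 1) := fun h => hx (box_mono p (by linarith) h)
  have hxμ : x - unitVec μ ∉ box p (S + 1) := by
    have h : x ∉ box p (S + 1 + 1) := by rwa [show S + 1 + 1 = S + 2 by ring]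
    exact sub_unitVec_not_mem_box h μ
  rw [hE1, hE1, curl_comm_eq_zero_of_not_mem_box hχ0 hxμ a μ ν, curl_comm_eq_zero_of_not_mem_box hχ0 hx1 a μ ν, sub_self]

include hC2 hχ1 in
/-- `δ₂C₂(x,ν) = 0` on the inner plateau `x ∈ box p (R − 2)`. [folklore] -/
theorem deltaTwo_C2_eq_zero_of_mem_box (x : Zd d) (hx : x ∈ box p (R - 2)) (ν : Fin d) :
    ∑ μ, (C2 (x - unitVec μ) μ ν - C2 x μ ν) = 0 := by
  refine Finset.sum_eq_zero fun μ _ => ?_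
  have hx1 : x ∈ box p (R - 1) := box_mono p (by linarith) hx
  have hxμ : x - unitVec μ ∈ box p (R - 1) := by
    have h := sub_unitVec_mem_box hx μ
    rwa [show R - 2 + 1 = R - 1 by ring] at h
  rw [hC2, hC2, deltaThree_comm_eq_zero_of_mem_box hχ1 hxμ γ μ ν, deltaThree_comm_eq_zero_of_mem_box hχ1 hx1 γ μ ν, sub_self]

include hC2 hχ0 in
/-- `δ₂C₂(x,ν) = 0` outside `box p (S + 2)`. [folklore] -/
theorem deltaTwo_C2_eq_zero_of_not_mem_box (x : Zd d) (hx : x ∉ box p (S + 2)) (ν : Fin d) :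
    ∑ μ, (C2 (x - unitVec μ) μ ν - C2 x μ ν) = 0 := by
  refine Finset.sum_eq_zero fun μ _ => ?_
  have hx1 : x ∉ box p (S + 1) := fun h => hx (box_mono p (by linarith) h)
  have hxμ : x - unitVec μ ∉ box p (S + 1) := by
    have h : x ∉ box p (S + 1 + 1) := by rwa [show S + 1 + 1 = S + 2 by ring]
    exact sub_unitVec_not_mem_box h μ
  rw [hC2, hC2, deltaThree_comm_eq_zero_of_not_mem_box hχ0 hxμ γ μ ν, deltaThree_comm_eq_zero_of_not_mem_box hχ0 hx1 γ μ ν, sub_self]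

end Support

/-! ## §2 Pointwise on the shell, with abstract far-field sizes (`d = 3`) -/

section Shell

variable (χ : Zd 3 → ℝ) (a : Zd 3 → Fin 3 → ℝ) (γ : Zd 3 → Fin 3 → Fin 3 → Fin 3 → ℝ) (E1 C2 : Zd 3 → Fin 3 → Fin 3 → ℝ)
  (hE1 : ∀ x μ ν, E1 x μ ν = (χ (x + unitVec μ) - χ x) * a (x + unitVec μ) ν - (χ (x + unitVec ν) - χ x) * a (x + unitVec ν) μ)
  (hC2 : ∀ x μ ν, C2 x μ ν = ∑ κ, (χ x - χ (x - unitVec κ)) * γ (x - unitVec κ) κ μ ν)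
  (p : Zd 3) (R Q : ℤ) {ρ ρ₂ : ℝ}
  (hχp : ∀ x (μ : Fin 3), |χ (x + unitVec μ) - χ x| ≤ ρ) (hχm : ∀ x (μ : Fin 3), |χ (x - unitVec μ) - χ x| ≤ ρ)
  (hχ2 : ∀ x (κ μ : Fin 3), |χ (x + unitVec κ + unitVec μ) - χ (x + unitVec κ) - χ (x + unitVec μ) + χ x| ≤ ρ₂)
  {As Ad Gs Gd : ℝ}
  (hAs : ∀ y, y ∉ box p Q → ∀ ν, |a y ν| ≤ As) (hAd : ∀ y, y ∉ box p Q → ∀ i ν, |a (y + unitVec i) ν - a y ν| ≤ Ad)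
  (hGs : ∀ y, y ∉ box p Q → ∀ κ μ ν, |γ y κ μ ν| ≤ Gs) (hGd : ∀ y, y ∉ box p Q → ∀ i κ μ ν, |γ (y + unitVec i) κ μ ν - γ y κ μ ν| ≤ Gd)
  (hQR : Q + 4 ≤ R)

include hQR in
/-- Off the inner plateau every evaluation point of the coboundary formulas is far: `x ∉ box p (R−2)` ⇒ `x`, `x ± e`, `x − e + e′`, `x − e − e′`
all lie outside `box p Q` when `Q + 4 ≤ R`. [folklore] -/
theorem far_points {x : Zd 3} (hx : x ∉ box p (R - 2)) (μ κ : Fin 3) :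
    x ∉ box p Q ∧ x + unitVec μ ∉ box p Q ∧ x - unitVec μ ∉ box p Q ∧ x - unitVec μ + unitVec κ ∉ box p Q ∧
      x - unitVec μ - unitVec κ ∉ box p Q := by
  have h0 : x ∉ box p (Q + 2) := fun h => hx (box_mono p (by linarith) h)
  have h1p : x + unitVec μ ∉ box p (Q + 1) := add_unitVec_not_mem_box (by rwa [show Q + 1 + 1 = Q + 2 by ring]) μ
  have h1m : x - unitVec μ ∉ box p (Q + 1) := sub_unitVec_not_mem_box (by rwa [show Q + 1 + 1 = Q + 2 by ring]) μ
  refine ⟨fun h => h0 (box_mono p (by linarith) h), fun h => h1p (box_mono p (by linarith) h),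
    fun h => h1m (box_mono p (by linarith) h), add_unitVec_not_mem_box h1m κ, sub_unitVec_not_mem_box h1m κ⟩

include hE1 hC2 hχp hχm hχ2 hAs hAd hGs hGd hQR in
/-- ★ **POINTWISE ON THE SHELL**: for `x ∉ box p (R − 2)`,
`Σ_ν (|δ₂E₁(x,ν)| + |δ₂C₂(x,ν)|) ≤ 18ρ·Ad + 18ρ₂·As + 27ρ·Gd + 27ρ₂·Gs` (✓COLLAR-COBD pointwise rows with every `a`∕`γ` letter far). [folklore] -/
theorem sum_abs_deltaTwo_comm_le_pt (x : Zd 3) (hx : x ∉ box p (R - 2)) :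
    ∑ ν, (|∑ μ, (E1 (x - unitVec μ) μ ν - E1 x μ ν)| + |∑ μ, (C2 (x - unitVec μ) μ ν - C2 x μ ν)|)
      ≤ 18 * ρ * Ad + 18 * ρ₂ * As + 27 * ρ * Gd + 27 * ρ₂ * Gs := by
  have hρ0 : 0 ≤ ρ := (abs_nonneg _).trans (hχp x 0)
  have hρ₂0 : 0 ≤ ρ₂ := (abs_nonneg _).trans (hχ2 x 0 0)
  -- the E₁ part, per `ν`
  have hE : ∀ ν, |∑ μ, (E1 (x - unitVec μ) μ ν - E1 x μ ν)| ≤ 6 * ρ * Ad + 6 * ρ₂ * As := by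
    intro ν
    refine (abs_deltaTwo_E1_le χ a E1 hE1 hχp (cutoff_sd_pure hχ2) (cutoff_sd_mixed hχ2) x ν).trans ?_
    have hterm : ∀ μ : Fin 3, ρ * (|a (x + unitVec μ) ν - a x ν| + |a (x + unitVec ν) μ - a (x - unitVec μ + unitVec ν) μ|)
        + ρ₂ * (|a (x + unitVec μ) ν| + |a (x - unitVec μ + unitVec ν) μ|) ≤ ρ * (Ad + Ad) + ρ₂ * (As + As) := by
      intro μ
      obtain ⟨hx0, hxp, _, hxmp, _⟩ := far_points p R Q hQR hx μ ν
      have h1 := hAd x hx0 μ ν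
      have h2 : |a (x + unitVec ν) μ - a (x - unitVec μ + unitVec ν) μ| ≤ Ad := by
        have h := hAd (x - unitVec μ + unitVec ν) hxmp μ μ
        rwa [show x - unitVec μ + unitVec ν + unitVec μ = x + unitVec ν by abel] at h
      have h3 := hAs (x + unitVec μ) hxp ν
      have h4 := hAs (x - unitVec μ + unitVec ν) hxmp μ
      gcongr
    calc ∑ μ : Fin 3, (ρ * (|a (x + unitVec μ) ν - a x ν| + |a (x + unitVec ν) μ - a (x - unitVec μ + unitVec ν) μ|)
          + ρ₂ * (|a (x + unitVec μ) ν| + |a (x - unitVec μ + unitVec ν) μ|))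
        ≤ ∑ _μ : Fin 3, (ρ * (Ad + Ad) + ρ₂ * (As + As)) := Finset.sum_le_sum fun μ _ => hterm μ
      _ = 6 * ρ * Ad + 6 * ρ₂ * As := by
          simp only [Finset.sum_const, Finset.card_univ, Fintype.card_fin, nsmul_eq_mul, Nat.cast_ofNat]; ring
  -- the C₂ part, per `ν`
  have hC : ∀ ν, |∑ μ, (C2 (x - unitVec μ) μ ν - C2 x μ ν)| ≤ 9 * ρ * Gd + 9 * ρ₂ * Gs := by
    intro ν
    refine (abs_deltaTwo_C2_le χ γ C2 hC2 (fun y κ => by rw [abs_sub_comm]; exact hχm y κ) (cutoff_sd_back hχ2) x ν).trans ?_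
    have hterm : ∀ μ κ : Fin 3, ρ * |γ (x - unitVec μ - unitVec κ) κ μ ν - γ (x - unitVec κ) κ μ ν| + ρ₂ * |γ (x - unitVec κ) κ μ ν|
        ≤ ρ * Gd + ρ₂ * Gs := by
      intro μ κ
      obtain ⟨_, _, hxm, _, hxmm⟩ := far_points p R Q hQR hx μ κ
      obtain ⟨_, _, hxk, _, _⟩ := far_points p R Q hQR hx κ μ
      have h1 : |γ (x - unitVec μ - unitVec κ) κ μ ν - γ (x - unitVec κ) κ μ ν| ≤ Gd := by
        have h := hGd (x - unitVec μ - unitVec κ) hxmm μ κ μ ν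
        rw [show x - unitVec μ - unitVec κ + unitVec μ = x - unitVec κ by abel] at h
        rwa [abs_sub_comm]
      have h2 := hGs (x - unitVec κ) hxk κ μ ν
      gcongr
    calc ∑ μ : Fin 3, ∑ κ : Fin 3, (ρ * |γ (x - unitVec μ - unitVec κ) κ μ ν - γ (x - unitVec κ) κ μ ν| + ρ₂ * |γ (x - unitVec κ) κ μ ν|)
        ≤ ∑ _μ : Fin 3, ∑ _κ : Fin 3, (ρ * Gd + ρ₂ * Gs) := Finset.sum_le_sum fun μ _ => Finset.sum_le_sum fun κ _ => hterm μ κ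
      _ = 9 * ρ * Gd + 9 * ρ₂ * Gs := by
          simp only [Finset.sum_const, Finset.card_univ, Fintype.card_fin, nsmul_eq_mul, Nat.cast_ofNat]; ring
  calc ∑ ν, (|∑ μ, (E1 (x - unitVec μ) μ ν - E1 x μ ν)| + |∑ μ, (C2 (x - unitVec μ) μ ν - C2 x μ ν)|)
      ≤ ∑ _ν : Fin 3, ((6 * ρ * Ad + 6 * ρ₂ * As) + (9 * ρ * Gd + 9 * ρ₂ * Gs)) := Finset.sum_le_sum fun ν _ => add_le_add (hE ν) (hC ν)
    _ = 18 * ρ * Ad + 18 * ρ₂ * As + 27 * ρ * Gd + 27 * ρ₂ * Gs := by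
        simp only [Finset.sum_const, Finset.card_univ, Fintype.card_fin, nsmul_eq_mul, Nat.cast_ofNat]; ring

/-! ## §3 Summed over a finite set -/

variable (S : ℤ) (hχ1 : ∀ y ∈ box p R, χ y = 1) (hχ0 : ∀ y, y ∉ box p S → χ y = 0)

include hE1 hC2 hχp hχm hχ2 hAs hAd hGs hGd hQR hχ1 hχ0 in
/-- ★★ **THE COLLAR MASS, SUMMED** (abstract sizes): for every finite `B`,
`Σ_{x∈B} Σ_ν (|δ₂E₁| + |δ₂C₂|) ≤ #(B ∩ (box p (S+2) ∖ box p (R−2)))·(18ρ·Ad + 18ρ₂·As + 27ρ·Gd + 27ρ₂·Gs)`. [folklore] -/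
theorem sum_abs_deltaTwo_comm_le (B : Finset (Zd 3)) :
    ∑ x ∈ B, ∑ ν, (|∑ μ, (E1 (x - unitVec μ) μ ν - E1 x μ ν)| + |∑ μ, (C2 (x - unitVec μ) μ ν - C2 x μ ν)|)
      ≤ ((B.filter fun x => x ∈ box p (S + 2) ∧ x ∉ box p (R - 2)).card : ℝ) *
        (18 * ρ * Ad + 18 * ρ₂ * As + 27 * ρ * Gd + 27 * ρ₂ * Gs) := by
  classical
  set K : ℝ := 18 * ρ * Ad + 18 * ρ₂ * As + 27 * ρ * Gd + 27 * ρ₂ * Gs with hK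
  have hpt : ∀ x, ∑ ν, (|∑ μ, (E1 (x - unitVec μ) μ ν - E1 x μ ν)| + |∑ μ, (C2 (x - unitVec μ) μ ν - C2 x μ ν)|)
      ≤ if x ∈ box p (S + 2) ∧ x ∉ box p (R - 2) then K else 0 := by
    intro x
    split_ifs with hsh
    · exact sum_abs_deltaTwo_comm_le_pt χ a γ E1 C2 hE1 hC2 p R Q hχp hχm hχ2 hAs hAd hGs hGd hQR x hsh.2
    · rw [not_and_or, not_not] at hsh
      refine le_of_eq (Finset.sum_eq_zero fun ν _ => ?_)
      rcases hsh with hout | hin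
      · rw [deltaTwo_E1_eq_zero_of_not_mem_box χ a E1 hE1 p S hχ0 x hout ν,
          deltaTwo_C2_eq_zero_of_not_mem_box χ γ C2 hC2 p S hχ0 x hout ν]; simp
      · rw [deltaTwo_E1_eq_zero_of_mem_box χ a E1 hE1 p R hχ1 x hin ν, deltaTwo_C2_eq_zero_of_mem_box χ γ C2 hC2 p R hχ1 x hin ν]; simp
  calc ∑ x ∈ B, ∑ ν, (|∑ μ, (E1 (x - unitVec μ) μ ν - E1 x μ ν)| + |∑ μ, (C2 (x - unitVec μ) μ ν - C2 x μ ν)|)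
      ≤ ∑ x ∈ B, (if x ∈ box p (S + 2) ∧ x ∉ box p (R - 2) then K else 0) := Finset.sum_le_sum fun x _ => hpt x
    _ = ((B.filter fun x => x ∈ box p (S + 2) ∧ x ∉ box p (R - 2)).card : ℝ) * K := by
        rw [Finset.sum_ite, Finset.sum_const_zero, add_zero, Finset.sum_const, nsmul_eq_mul]

end Shell

/-! ## §4 The monopole instance: the sizes of `a`, `∇a`, `γ`, `∇γ` on the shell from the free Green kernel -/

section Monopole

variable {C₁ C₂ : ℝ}
  (hK1 : ∀ (e : Fin 3) (w : Zd 3) (n : ℕ), 1 ≤ n → w ∉ box (0 : Zd 3) ((n : ℤ) - 1) →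
    |latticeGreen (w + unitVec e) - latticeGreen w| ≤ C₁ / (n : ℝ) ^ 2)
  (hK2 : ∀ (e : Fin 3) (w : Zd 3) (n : ℕ), 2 ≤ n → w ∉ box (0 : Zd 3) ((n : ℤ) - 1) → ∀ i : Fin 3,
    |(latticeGreen (w + unitVec i + unitVec e) - latticeGreen (w + unitVec i)) - (latticeGreen (w + unitVec e) - latticeGreen w)| ≤ C₂ / (n : ℝ) ^ 3)
  (ω β : Zd 3 → Fin 3 → Fin 3 → ℝ) (a : Zd 3 → Fin 3 → ℝ) (γ : Zd 3 → Fin 3 → Fin 3 → Fin 3 → ℝ) (p : Zd 3) (ℓ : ℕ)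
  (hβ : ∀ x μ ν, β x μ ν = ∑ y ∈ box p ℓ, latticeGreen (x - y) / 2 * ω y μ ν)
  (ha : ∀ x ν, a x ν = ∑ μ, (β (x - unitVec μ) μ ν - β x μ ν))
  (hγ : ∀ x κ μ ν, γ x κ μ ν = (β (x + unitVec κ) μ ν - β x μ ν) - (β (x + unitVec μ) κ ν - β x κ ν) + (β (x + unitVec ν) κ μ - β x κ μ))
  (χ : Zd 3 → ℝ) (E1 C2 : Zd 3 → Fin 3 → Fin 3 → ℝ)
  (hE1 : ∀ x μ ν, E1 x μ ν = (χ (x + unitVec μ) - χ x) * a (x + unitVec μ) ν - (χ (x + unitVec ν) - χ x) * a (x + unitVec ν) μ)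
  (hC2 : ∀ x μ ν, C2 x μ ν = ∑ κ, (χ x - χ (x - unitVec κ)) * γ (x - unitVec κ) κ μ ν)
  (R S : ℕ) {ρ ρ₂ : ℝ}
  (hχ1 : ∀ y ∈ box p (R : ℤ), χ y = 1) (hχ0 : ∀ y, y ∉ box p (S : ℤ) → χ y = 0)
  (hχp : ∀ x (μ : Fin 3), |χ (x + unitVec μ) - χ x| ≤ ρ) (hχm : ∀ x (μ : Fin 3), |χ (x - unitVec μ) - χ x| ≤ ρ)
  (hχ2 : ∀ x (κ μ : Fin 3), |χ (x + unitVec κ + unitVec μ) - χ (x + unitVec κ) - χ (x + unitVec μ) + χ x| ≤ ρ₂)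

include hK1 hK2 hβ ha hγ hE1 hC2 hχ1 hχ0 hχp hχm hχ2 in
/-- ★★★ **(R7-row, `ℤ³` side) THE COLLAR MASS OF THE CUTOFF COMMUTATORS IS FAR FIELD**: for `0 ≤ C₁, C₂`, `N ≥ 2`, `N + ℓ + 4 ≤ R` and every
finite `B`: `Σ_{x∈B} Σ_ν (|δ₂E₁(x,ν)| + |δ₂C₂(x,ν)|) ≤ #(B ∩ (box p (S+2) ∖ box p (R−2))) · ((135∕2)·(ρ·(C₂∕N³) + ρ₂·(C₁∕N²))·M₀)`,
`M₀ = Σ_{μν}Σ_{y∈box p ℓ}|ω(y,μ,ν)|` (✓MONOPOLE ×4 at `Q := N + ℓ`). [cite: Balaban1984PropagatorsII, (1.9) p.226] -/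
theorem collarMass_le_far (hC₁ : 0 ≤ C₁) (hC₂ : 0 ≤ C₂) (N : ℕ) (hN : 2 ≤ N) (hR : (N : ℤ) + ℓ + 4 ≤ R) (B : Finset (Zd 3)) :
    ∑ x ∈ B, ∑ ν, (|∑ μ, (E1 (x - unitVec μ) μ ν - E1 x μ ν)| + |∑ μ, (C2 (x - unitVec μ) μ ν - C2 x μ ν)|)
      ≤ ((B.filter fun x => x ∈ box p ((S : ℤ) + 2) ∧ x ∉ box p ((R : ℤ) - 2)).card : ℝ) *
        (135 / 2 * (ρ * (C₂ / (N : ℝ) ^ 3) + ρ₂ * (C₁ / (N : ℝ) ^ 2)) * ∑ μ', ∑ ν', ∑ y' ∈ box p (ℓ : ℤ), |ω y' μ' ν'|) := by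
  set M₀ : ℝ := ∑ μ', ∑ ν', ∑ y' ∈ box p (ℓ : ℤ), |ω y' μ' ν'| with hM₀
  have hN1 : 1 ≤ N := le_trans (by norm_num) hN
  -- the four far-field sizes off `box p (N + ℓ)` (⊇ `box p (N + ℓ − 1)` for the `γ` rows)
  have hAs : ∀ y, y ∉ box p ((N : ℤ) + ℓ) → ∀ ν, |a y ν| ≤ 3 / 2 * (C₁ / (N : ℝ) ^ 2) * M₀ :=
    fun y hy ν => abs_potential_le_far_monopole hK1 ω β a p ℓ hβ ha hC₁ y ν N hN1 hy
  have hAd : ∀ y, y ∉ box p ((N : ℤ) + ℓ) → ∀ i ν, |a (y + unitVec i) ν - a y ν| ≤ 3 / 2 * (C₂ / (N : ℝ) ^ 3) * M₀ :=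
    fun y hy i ν => abs_fdiff_potential_le_far_monopole hK2 ω β a p ℓ hβ ha hC₂ y i ν N hN hy
  have hsub : ∀ y : Zd 3, y ∉ box p ((N : ℤ) + ℓ) → y ∉ box p ((N : ℤ) + ℓ - 1) := fun y hy h => hy (box_mono p (by linarith) h)
  have hGs : ∀ y, y ∉ box p ((N : ℤ) + ℓ) → ∀ κ μ ν, |γ y κ μ ν| ≤ 3 / 2 * (C₁ / (N : ℝ) ^ 2) * M₀ :=
    fun y hy κ μ ν => abs_dTwo_le_far_monopole hK1 ω β γ p ℓ hβ hγ hC₁ y κ μ ν N hN1 (hsub y hy)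
  have hGd : ∀ y, y ∉ box p ((N : ℤ) + ℓ) → ∀ i κ μ ν, |γ (y + unitVec i) κ μ ν - γ y κ μ ν| ≤ 3 / 2 * (C₂ / (N : ℝ) ^ 3) * M₀ :=
    fun y hy i κ μ ν => abs_fdiff_dTwo_le_far_monopole hK2 ω β γ p ℓ hβ hγ hC₂ y i κ μ ν N hN (hsub y hy)
  have hQR : (N : ℤ) + ℓ + 4 ≤ R := hR
  have h := sum_abs_deltaTwo_comm_le χ a γ E1 C2 hE1 hC2 p (R : ℤ) ((N : ℤ) + ℓ) hχp hχm hχ2 hAs hAd hGs hGd hQR (S : ℤ) hχ1 hχ0 B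
  refine h.trans (le_of_eq ?_)
  ring

include hK1 hK2 hβ ha hγ hE1 hC2 hχ1 hχ0 hχp hχm hχ2 in
/-- ★★ **(R7-row, `B`-free shell count)**: the same with `#(box p (S+2))` — with `ρ = 2∕R`, `ρ₂ = 4∕R²`, `S = 3R`, `N ≍ R∕2` this is
`W ≤ A·(C₁ + C₂)·M₀∕R`, the KNIT-PLAN's R7 size. [cite: Balaban1984PropagatorsII, (1.9) p.226] -/
theorem collarMass_le_far' (hC₁ : 0 ≤ C₁) (hC₂ : 0 ≤ C₂) (N : ℕ) (hN : 2 ≤ N) (hR : (N : ℤ) + ℓ + 4 ≤ R)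
    (hρ : 0 ≤ ρ) (hρ₂ : 0 ≤ ρ₂) (B : Finset (Zd 3)) :
    ∑ x ∈ B, ∑ ν, (|∑ μ, (E1 (x - unitVec μ) μ ν - E1 x μ ν)| + |∑ μ, (C2 (x - unitVec μ) μ ν - C2 x μ ν)|)
      ≤ ((box p ((S : ℤ) + 2)).card : ℝ) *
        (135 / 2 * (ρ * (C₂ / (N : ℝ) ^ 3) + ρ₂ * (C₁ / (N : ℝ) ^ 2)) * ∑ μ', ∑ ν', ∑ y' ∈ box p (ℓ : ℤ), |ω y' μ' ν'|) := by
  classical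
  have h := collarMass_le_far hK1 hK2 ω β a γ p ℓ hβ ha hγ χ E1 C2 hE1 hC2 R S hχ1 hχ0 hχp hχm hχ2 hC₁ hC₂ N hN hR B
  have hsubset : (B.filter fun x => x ∈ box p ((S : ℤ) + 2) ∧ x ∉ box p ((R : ℤ) - 2)) ⊆ box p ((S : ℤ) + 2) :=
    fun x hx => (Finset.mem_filter.mp hx).2.1
  have hM0 : 0 ≤ ∑ μ', ∑ ν', ∑ y' ∈ box p (ℓ : ℤ), |ω y' μ' ν'| :=
    Finset.sum_nonneg fun _ _ => Finset.sum_nonneg fun _ _ => Finset.sum_nonneg fun _ _ => abs_nonneg _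
  refine h.trans (mul_le_mul_of_nonneg_right ?_ (by positivity))
  exact_mod_cast Finset.card_le_card hsubset

end Monopole

end Summit.QuantumFields.YangMills.Theorems.UnitScaleGibbsTruncatedPotentialCollarMass

end
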